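import Summits.AnomalousDissipation.AnomalousDissipation.Theorems.TaylorCertificatesTargetImpliesSteadyDirect
import Literature.Analysis.FluidPDE.StatisticalSolutionEnergyEq
import Literature.Analysis.FunctionSpaces.TorusSobolevSpaceProofs
import Literature.Analysis.FunctionSpaces.TorusFourierCalculus

/-!
# `TaylorCertificates.FloorCertificateEnsembleCeiling` (stmt-AnomalousDissipation-14086) — negative side II:
# no sub-inertial ceiling (Doering–Foias `Re ≳ Gr^{1/2}`, steady form)

The CEILING half of the crux `X = FloorCertificateEnsembleCeiling` asks that every stationary statistical solution of
`NS_ν(f)` with integrable energy have mean energy `≤ E`, with `E` independent of `ν ∈ (0, ν₀)`. This file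
(cdisprove seat `refuter-cdisprove-stmt-AnomalousDissipation-14086-g2-0`, 2026-08-16; content of the crux work file
`Cruxes/FloorCertificateEnsembleCeiling/Disproof.lean` §D.2 re-based on `TaylorCertificatesTargetImpliesSteadyDirect`
and the Literature layer only) proves the a priori LOWER bound every such `E` obeys and refutes the corresponding
natural strengthening of `X`, for EVERY force:

* `steady_force_identity` — testing a steady weak solution `u` of `NS_ν(f)` with the admissible field `w = f`:
  `‖f‖₂² + ν (u, Δf) + ∫ (u ⊗ u) : ∇f = 0`;
* `force_sq_le_of_steady` — hence `‖f‖₂² ≤ ν |u| ‖Δf‖₂ + K |u|²`, `K = sup ‖∇f‖` (the Doering–Foias 2002 lower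
  bound `Re ≳ Gr^{1/2}` in steady form);
* `force_sq_le_of_ceiling` — a ν-uniform ceiling `E` on `(0, ν₀)` satisfies `‖f‖₂² ≤ K E`: the Leray–Temam steady
  states (exist at every `ν`, `Temam1979_exists_steadyWeakSolution_holds`) are Dirac stationary statistical solutions
  of energy `≤ E`; let `ν → 0`;
* `not_ceilingSubInertial` — so NO force admits a ceiling below its inertial scale, `K E < ‖f‖₂²`; in particular the
  strengthening of `X` with a sub-inertial ceiling is false (`floorCertificateEnsembleCeiling_subInertial_false`):
  the ceiling of `X` can at best assert SATURATION of the a priori bound `U² ≳ F ℓ_f`, never undercut it.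

References: Doering–Foias, J. Fluid Mech. 467 (2002) §2; Foias–Manley–Rosa–Temam 2001, Ch. IV §1.2.
-/

noncomputable section

set_option linter.dupNamespace false

open MeasureTheory UnitAddTorus Filter Topology
open scoped InnerProductSpace ENNReal

namespace Summit.AnomalousDissipation.AnomalousDissipation.Theorems.FloorCertificateEnsembleCeiling.Negative

open Literature.Analysis.FunctionSpaces Literature.Analysis.FluidPDE
open Summit.AnomalousDissipation.AnomalousDissipation.Theses.TaylorCertificates
open Summit.AnomalousDissipation.AnomalousDissipation.Theorems.TargetImpliesSteadyDirect


/-- A sup bound of the velocity gradient of a smooth field: `‖Df(x)‖ ≤ K`, `K ≥ 0`. -/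
theorem exists_fderiv_bound {f : (UnitAddTorus (Fin 3) → EuclideanSpace ℝ (Fin 3))} (hf : Torus.IsSmooth f) :
    ∃ K : ℝ, 0 ≤ K ∧ ∀ x, ‖Torus.fderiv f x‖ ≤ K := by
  obtain ⟨K, hK⟩ := Torus.exists_forall_norm_le_of_continuous_torus (Torus.continuous_fderiv_of_isSmooth hf)
  exact ⟨max K 0, le_max_right _ _, fun x => (hK x).trans (le_max_left _ _)⟩

/-- The inertial pairing against a field with `‖Df‖ ≤ K` is bounded by `K |u|²`. -/
theorem abs_inertialPairing_le {f : (UnitAddTorus (Fin 3) → EuclideanSpace ℝ (Fin 3))} {K : ℝ} (hK : ∀ x, ‖Torus.fderiv f x‖ ≤ K) (u : (Torus.energySpace (Fin 3))) :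
    |Torus.inertialPairing (u : Lp (EuclideanSpace ℝ (Fin 3)) 2 (volume : Measure (UnitAddTorus (Fin 3)))) f| ≤ K * ‖u‖ ^ 2 := by
  have hmem : MemLp ((u : Lp (EuclideanSpace ℝ (Fin 3)) 2 (volume : Measure (UnitAddTorus (Fin 3)))) : (UnitAddTorus (Fin 3) → EuclideanSpace ℝ (Fin 3))) 2 volume := Lp.memLp _
  have hint : Integrable (fun x => ‖((u : Lp (EuclideanSpace ℝ (Fin 3)) 2 (volume : Measure (UnitAddTorus (Fin 3)))) : (UnitAddTorus (Fin 3) → EuclideanSpace ℝ (Fin 3))) x‖ ^ 2) volume :=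
    (memLp_two_iff_integrable_sq_norm hmem.1).1 hmem
  have h : |Torus.inertialPairing (u : Lp (EuclideanSpace ℝ (Fin 3)) 2 (volume : Measure (UnitAddTorus (Fin 3)))) f| ≤ K * ‖(u : Lp (EuclideanSpace ℝ (Fin 3)) 2 (volume : Measure (UnitAddTorus (Fin 3))))‖ ^ 2 := by
    unfold Torus.inertialPairing
    rw [← Torus.integral_norm_sq_coe_eq (u : Lp (EuclideanSpace ℝ (Fin 3)) 2 (volume : Measure (UnitAddTorus (Fin 3)))), ← integral_const_mul, ← Real.norm_eq_abs]
    refine norm_integral_le_of_norm_le (hint.const_mul K) (ae_of_all _ fun x => ?_)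
    rw [Real.norm_eq_abs]
    calc |⟪Torus.fderiv f x (((u : Lp (EuclideanSpace ℝ (Fin 3)) 2 (volume : Measure (UnitAddTorus (Fin 3)))) : (UnitAddTorus (Fin 3) → EuclideanSpace ℝ (Fin 3))) x), ((u : Lp (EuclideanSpace ℝ (Fin 3)) 2 (volume : Measure (UnitAddTorus (Fin 3)))) : (UnitAddTorus (Fin 3) → EuclideanSpace ℝ (Fin 3))) x⟫_ℝ|
          ≤ ‖Torus.fderiv f x (((u : Lp (EuclideanSpace ℝ (Fin 3)) 2 (volume : Measure (UnitAddTorus (Fin 3)))) : (UnitAddTorus (Fin 3) → EuclideanSpace ℝ (Fin 3))) x)‖ * ‖((u : Lp (EuclideanSpace ℝ (Fin 3)) 2 (volume : Measure (UnitAddTorus (Fin 3)))) : (UnitAddTorus (Fin 3) → EuclideanSpace ℝ (Fin 3))) x‖ := abs_real_inner_le_norm _ _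
      _ ≤ (‖Torus.fderiv f x‖ * ‖((u : Lp (EuclideanSpace ℝ (Fin 3)) 2 (volume : Measure (UnitAddTorus (Fin 3)))) : (UnitAddTorus (Fin 3) → EuclideanSpace ℝ (Fin 3))) x‖) * ‖((u : Lp (EuclideanSpace ℝ (Fin 3)) 2 (volume : Measure (UnitAddTorus (Fin 3)))) : (UnitAddTorus (Fin 3) → EuclideanSpace ℝ (Fin 3))) x‖ :=
          mul_le_mul_of_nonneg_right (ContinuousLinearMap.le_opNorm _ _) (norm_nonneg _)
      _ ≤ (K * ‖((u : Lp (EuclideanSpace ℝ (Fin 3)) 2 (volume : Measure (UnitAddTorus (Fin 3)))) : (UnitAddTorus (Fin 3) → EuclideanSpace ℝ (Fin 3))) x‖) * ‖((u : Lp (EuclideanSpace ℝ (Fin 3)) 2 (volume : Measure (UnitAddTorus (Fin 3)))) : (UnitAddTorus (Fin 3) → EuclideanSpace ℝ (Fin 3))) x‖ :=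
          mul_le_mul_of_nonneg_right (mul_le_mul_of_nonneg_right (hK x) (norm_nonneg _)) (norm_nonneg _)
      _ = K * ‖((u : Lp (EuclideanSpace ℝ (Fin 3)) 2 (volume : Measure (UnitAddTorus (Fin 3)))) : (UnitAddTorus (Fin 3) → EuclideanSpace ℝ (Fin 3))) x‖ ^ 2 := by ring
  exact h

/-- **Testing a steady state with its own force**: for a steady weak solution `u` of `NS_ν(f)` and the
admissible test field `w = f`, `‖f‖₂² + ν (u, Δf) + ∫ (u ⊗ u) : ∇f = 0`. -/
theorem steady_force_identity {ν : ℝ} {f : (UnitAddTorus (Fin 3) → EuclideanSpace ℝ (Fin 3))} (hfs : Torus.IsSmooth f) (hfd : Torus.IsDivFree f)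
    (hfz : Torus.HasZeroMean f) {u : (Torus.energySpace (Fin 3))} (hu : Torus.IsSteadyWeakSolution ν f u) :
    (∫ x, ‖f x‖ ^ 2) + ν * Torus.pairing (u : Lp (EuclideanSpace ℝ (Fin 3)) 2 (volume : Measure (UnitAddTorus (Fin 3)))) (Torus.laplacian f) + Torus.inertialPairing (u : Lp (EuclideanSpace ℝ (Fin 3)) 2 (volume : Measure (UnitAddTorus (Fin 3)))) f = 0 := by
  have h := hu f hfs hfd hfz
  unfold Torus.nsGeneratorPairing at h
  have h1 : (∫ x, ⟪f x, f x⟫_ℝ) = ∫ x, ‖f x‖ ^ 2 :=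
    integral_congr_ae (ae_of_all _ fun x => real_inner_self_eq_norm_sq _)
  rw [h1] at h
  exact h

/-- **The inertial lower bound on the energy of a steady state (Doering–Foias, steady form)**:
`‖f‖₂² ≤ ν |u| ‖Δf‖₂ + K |u|²` for every steady weak solution `u` of `NS_ν(f)`, `K = sup ‖∇f‖`. -/
theorem force_sq_le_of_steady {ν : ℝ} (hν : 0 ≤ ν) {f : (UnitAddTorus (Fin 3) → EuclideanSpace ℝ (Fin 3))} (hfs : Torus.IsSmooth f) (hfd : Torus.IsDivFree f)
    (hfz : Torus.HasZeroMean f) {K : ℝ} (hK : ∀ x, ‖Torus.fderiv f x‖ ≤ K) {u : (Torus.energySpace (Fin 3))}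
    (hu : Torus.IsSteadyWeakSolution ν f u) :
    ∫ x, ‖f x‖ ^ 2 ≤ ν * (‖u‖ * ‖(hfs.laplacian.memLp 2).toLp (Torus.laplacian f)‖) + K * ‖u‖ ^ 2 := by
  have hid := steady_force_identity hfs hfd hfz hu
  have h1 : |Torus.pairing (u : Lp (EuclideanSpace ℝ (Fin 3)) 2 (volume : Measure (UnitAddTorus (Fin 3)))) (Torus.laplacian f)| ≤ ‖u‖ * ‖(hfs.laplacian.memLp 2).toLp (Torus.laplacian f)‖ :=
    Torus.abs_pairing_coe_le (hfs.laplacian.memLp 2) u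
  have h2 := abs_inertialPairing_le hK u
  have h3 : -(Torus.pairing (u : Lp (EuclideanSpace ℝ (Fin 3)) 2 (volume : Measure (UnitAddTorus (Fin 3)))) (Torus.laplacian f)) ≤ ‖u‖ * ‖(hfs.laplacian.memLp 2).toLp (Torus.laplacian f)‖ :=
    (neg_le_abs _).trans h1
  have h4 : -(Torus.inertialPairing (u : Lp (EuclideanSpace ℝ (Fin 3)) 2 (volume : Measure (UnitAddTorus (Fin 3)))) f) ≤ K * ‖u‖ ^ 2 := (neg_le_abs _).trans h2
  nlinarith [mul_le_mul_of_nonneg_left h3 hν]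

/-- **No sub-inertial ceiling (Doering–Foias lower bound `Re ≳ Gr^{1/2}`, steady form).** If the ceiling holds
at `f` with constant `E` for all `ν ∈ (0, ν₀)`, then `‖f‖₂² ≤ K · E` for every sup bound `K` of `‖∇f‖`: the
Leray–Temam steady states (exist at every `ν`) have `|u|² ≤ E` (Dirac masses) and obey
`‖f‖₂² ≤ ν |u| ‖Δf‖₂ + K|u|²`; let `ν → 0`. -/
theorem force_sq_le_of_ceiling {f : (UnitAddTorus (Fin 3) → EuclideanSpace ℝ (Fin 3))} (hfs : Torus.IsSmooth f) (hfd : Torus.IsDivFree f)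
    (hfz : Torus.HasZeroMean f) {K : ℝ} (hK : ∀ x, ‖Torus.fderiv f x‖ ≤ K) {E ν₀ : ℝ} (hν₀ : 0 < ν₀)
    (hceil : ∀ ν : ℝ, 0 < ν → ν < ν₀ → ∀ μ : Measure (Torus.energySpace (Fin 3)), Torus.IsStationaryStatisticalSolution ν f μ →
      Integrable (fun v : (Torus.energySpace (Fin 3)) => ‖v‖ ^ 2) μ → Torus.ensembleEnergy μ ≤ E) : ∫ x, ‖f x‖ ^ 2 ≤ K * E := by
  have hf2 : MemLp f 2 volume := hfs.memLp 2
  set L : ℝ := ‖(hfs.laplacian.memLp 2).toLp (Torus.laplacian f)‖ with hL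
  have hL0 : 0 ≤ L := norm_nonneg _
  have hK0 : 0 ≤ K := (norm_nonneg _).trans (hK 0)
  have key : ∀ ν : ℝ, 0 < ν → ν < ν₀ → 0 ≤ E ∧ ∫ x, ‖f x‖ ^ 2 ≤ ν * (Real.sqrt E * L) + K * E := by
    intro ν hν hνν₀
    obtain ⟨u, hV, hu⟩ := Torus.Temam1979_exists_steadyWeakSolution_holds (by simp) hν hf2
    have hE : ‖u‖ ^ 2 ≤ E := norm_sq_le_of_ensemble_ceiling hν hf2 (hceil ν hν hνν₀) hV hu
    have hE0 : 0 ≤ E := (sq_nonneg _).trans hE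
    have hu_le : ‖u‖ ≤ Real.sqrt E := by
      rw [← Real.sqrt_sq (norm_nonneg u)]
      exact Real.sqrt_le_sqrt hE
    have h := force_sq_le_of_steady hν.le hfs hfd hfz hK hu
    refine ⟨hE0, h.trans ?_⟩
    have h1 : ν * (‖u‖ * L) ≤ ν * (Real.sqrt E * L) :=
      mul_le_mul_of_nonneg_left (mul_le_mul_of_nonneg_right hu_le hL0) hν.le
    have h2 : K * ‖u‖ ^ 2 ≤ K * E := mul_le_mul_of_nonneg_left hE hK0
    linarith
  by_contra hcon
  push Not at hcon
  set δ : ℝ := (∫ x, ‖f x‖ ^ 2) - K * E with hδ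
  have hδ0 : 0 < δ := by linarith
  obtain ⟨hE0, -⟩ := key (ν₀ / 2) (half_pos hν₀) (by linarith)
  set M : ℝ := Real.sqrt E * L + 1 with hM
  have hM0 : 0 < M := by positivity
  set ν : ℝ := min (ν₀ / 2) (δ / (2 * M)) with hνdef
  have hν : 0 < ν := lt_min (half_pos hν₀) (by positivity)
  have hνν₀ : ν < ν₀ := (min_le_left _ _).trans_lt (half_lt_self hν₀)
  have hνδ : ν ≤ δ / (2 * M) := min_le_right _ _
  obtain ⟨-, h⟩ := key ν hν hνν₀
  have h1 : ν * (Real.sqrt E * L) ≤ ν * M := mul_le_mul_of_nonneg_left (by linarith) hν.le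
  have h2 : ν * M ≤ δ / (2 * M) * M := mul_le_mul_of_nonneg_right hνδ hM0.le
  have h3 : δ / (2 * M) * M = δ / 2 := by field_simp
  linarith

/-- **No sub-inertial ceiling, for any force.** No smooth solenoidal mean-zero `f` with `‖∇f‖ ≤ K` admits a
ν-uniform ensemble ceiling `E` with `K · E < ‖f‖₂²` on an interval `(0, ν₀)`. -/
theorem not_ceilingSubInertial :
    ¬ ∃ f : (UnitAddTorus (Fin 3) → EuclideanSpace ℝ (Fin 3)), Torus.IsSmooth f ∧ Torus.IsDivFree f ∧ Torus.HasZeroMean f ∧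
      ∃ K : ℝ, (∀ x, ‖Torus.fderiv f x‖ ≤ K) ∧ ∃ (E ν₀ : ℝ), 0 < ν₀ ∧ K * E < (∫ x, ‖f x‖ ^ 2) ∧
        ∀ ν : ℝ, 0 < ν → ν < ν₀ → ∀ μ : Measure (Torus.energySpace (Fin 3)), Torus.IsStationaryStatisticalSolution ν f μ →
          Integrable (fun v : (Torus.energySpace (Fin 3)) => ‖v‖ ^ 2) μ → Torus.ensembleEnergy μ ≤ E := by
  rintro ⟨f, hfs, hfd, hfz, K, hK, E, ν₀, hν₀, hlt, h⟩
  have := force_sq_le_of_ceiling hfs hfd hfz hK hν₀ h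
  linarith

/-- **The sub-inertial strengthening of `X` is false**: if `X` holds with witness `(f, ε₀, E, ν₀)` then
`‖f‖₂² ≤ K · E` for every sup bound `K` of `‖∇f‖` (uses only the ceiling half). -/
theorem floorCertificateEnsembleCeiling_subInertial_false :
    ¬ ∃ f : (UnitAddTorus (Fin 3) → EuclideanSpace ℝ (Fin 3)), Torus.IsSmooth f ∧ Torus.IsDivFree f ∧ Torus.HasZeroMean f ∧
      ∃ K : ℝ, (∀ x, ‖Torus.fderiv f x‖ ≤ K) ∧
      ∃ (ε₀ E ν₀ : ℝ), 0 < ε₀ ∧ 0 < ν₀ ∧ K * E < (∫ x, ‖f x‖ ^ 2) ∧ ∀ ν : ℝ, 0 < ν → ν < ν₀ →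
        (∃ (Φ₁ : Torus.CylindricalTest (Fin 3)) (θ₁ : ℝ), θ₁ ≤ 0 ∧ ∀ u : (Torus.energySpace (Fin 3)),
          Torus.eGradNormSq ((u : Lp (EuclideanSpace ℝ (Fin 3)) 2 (volume : Measure (UnitAddTorus (Fin 3)))) : (UnitAddTorus (Fin 3) → EuclideanSpace ℝ (Fin 3))) ≠ ⊤ → ‖u‖ ^ 2 ≤ 16 * (∫ x, ‖f x‖ ^ 2) / ν ^ 2 →
            ε₀ ≤ ν * (Torus.eGradNormSq ((u : Lp (EuclideanSpace ℝ (Fin 3)) 2 (volume : Measure (UnitAddTorus (Fin 3)))) : (UnitAddTorus (Fin 3) → EuclideanSpace ℝ (Fin 3)))).toReal + Torus.nsGeneratorPairing ν f u (Φ₁.grad u) +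
              2 * θ₁ * (Torus.pairing (u : Lp (EuclideanSpace ℝ (Fin 3)) 2 (volume : Measure (UnitAddTorus (Fin 3)))) f - ν * (Torus.eGradNormSq ((u : Lp (EuclideanSpace ℝ (Fin 3)) 2 (volume : Measure (UnitAddTorus (Fin 3)))) : (UnitAddTorus (Fin 3) → EuclideanSpace ℝ (Fin 3)))).toReal)) ∧
        (∀ μ : Measure (Torus.energySpace (Fin 3)), Torus.IsStationaryStatisticalSolution ν f μ →
          Integrable (fun v : (Torus.energySpace (Fin 3)) => ‖v‖ ^ 2) μ → Torus.ensembleEnergy μ ≤ E) := by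
  rintro ⟨f, hfs, hfd, hfz, K, hK, ε₀, E, ν₀, -, hν₀, hlt, h⟩
  have := force_sq_le_of_ceiling hfs hfd hfz hK hν₀ (fun ν hν hνν₀ => (h ν hν hνν₀).2)
  linarith

end Summit.AnomalousDissipation.AnomalousDissipation.Theorems.FloorCertificateEnsembleCeiling.Negative

end
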